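import Mathlib
import Summits.KontsevichZagierPeriods.Zeta5Search.ClusterValuation
import Summits.KontsevichZagierPeriods.Zeta5Search.DenomLaw.ThresholdModelBridgeClassExp

/-!
# ζ(5) search — DENOM-LAW: the threshold model, PART III (bridge to the tree's `R_b`), part C: octave shifts and tree examples

Cell `pub-zeta5`, track DENOM-LAW (K1 typing order item (1), «ThresholdModel port»): denom-engine-d2 g13's kernel-checked scratch module
`denom-law/engine-d2/g13/lean/LevelCensusBridge.lean` PART III (THRESHOLD-X5) filed VERBATIM in three parts (≤ 400 lines each; docstrings added
where the scratch file had none) by denom-prover-d1 g5.  Part C of 3.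
HONEST FRAMING: systematic search; MODEL/structure side — elementary integer arithmetic identifying the tree's `netExp`/`classSet`/`classExp`/`CentreIn` with the level census; nothing about ζ(5); no γ; no irrationality claim; records in print UNMOVED.
The mathematical header of PART III is the second module docstring of part A (`ThresholdModelBridge.lean`).
-/

namespace Summit.KontsevichZagierPeriods.Zeta5Search.DenomLaw.ThresholdModel.Rho

section TreeBridge

open Summit.KontsevichZagierPeriods.Zeta5Search.ClusterValuation (blockCount netExp classSet classExp CentreIn classPoleCount)
open Summit.KontsevichZagierPeriods.Zeta5Search.BigPrime (block)

section Octave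
variable {b : ℕ → ℤ} {p : ℕ} {m k : ℤ}

/-- the octave shift `σ_k` of a tree cell: `b₀ ↦ b₀ + 3kp`, `b_j ↦ b_j + kp` (`m ↦ m + k`). -/
def octShift (b : ℕ → ℤ) (p k : ℤ) : ℕ → ℤ := fun i => if i = 0 then b 0 + 3 * (k * p) else b i + k * p

/-- `octShift` moves `b₀` by `3kp`. -/
theorem octShift_zero (b : ℕ → ℤ) (p k : ℤ) : octShift b p k 0 = b 0 + 3 * (k * p) := if_pos rfl

/-- `octShift` moves every lower parameter by `kp`. -/
theorem lowerB_octShift (b : ℕ → ℤ) (p k : ℤ) : lowerB (octShift b p k) = fun j => lowerB b j + k * p := by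
  funext j; simp only [lowerB, octShift, if_neg (Nat.succ_ne_zero _)]

/-- `ρ` is `σ`-invariant. -/
theorem rhob_octShift (b : ℕ → ℤ) (p m k : ℤ) :
    rhob p (m + k) (octShift b p k 0) (lowerB (octShift b p k)) = rhob p m (b 0) (lowerB b) := by
  rw [lowerB_octShift, octShift_zero]; funext j; unfold rhob; ring

/-- `R₀` is `σ`-invariant. -/
theorem R0b_octShift (b : ℕ → ℤ) (p m k : ℤ) : R0b p (m + k) (octShift b p k 0) = R0b p m (b 0) := by
  rw [octShift_zero]; unfold R0b; ring

/-- the class offset of a residue is `σ`-invariant. -/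
theorem uOf_octShift (b : ℕ → ℤ) (p m k x : ℤ) : uOf p (m + k) (octShift b p k 0) x = uOf p m (b 0) x := by
  rw [octShift_zero]; unfold uOf
  rw [show 2 * x - (b 0 + 3 * (k * p)) + 3 * (p * (m + k)) - p = 2 * x - b 0 + 3 * (p * m) - p by ring]

/-- **OCTAVE SHIFT LAW**: `E_x(σ_k b) = E_x(b) − 4k` for the SAME residue `x` (level box at octave `m`, `m + k ≥ 1`, `p` odd). -/
theorem classExp_octShift (h : LevelBox (p : ℤ) (R0b p m (b 0)) (rhob p m (b 0) (lowerB b))) (hm : 1 ≤ m)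
    (hmk : 1 ≤ m + k) (hp2 : (p : ℤ) % 2 = 1) (x : ℕ) :
    classExp (octShift b p k) p x = classExp b p x - 4 * k := by
  have h' : LevelBox (p : ℤ) (R0b p (m + k) (octShift b p k 0)) (rhob p (m + k) (octShift b p k 0) (lowerB (octShift b p k))) := by
    rw [rhob_octShift, R0b_octShift]; exact h
  rw [classExp_eq_uOf h' hmk hp2 x, classExp_eq_uOf h hm hp2 x, rhob_octShift, R0b_octShift, uOf_octShift]
  ring

end Octave

/-! ### Kernel examples on the standing (1,11) cell `(28; 10,9,9,8,7,7,7)` as a TREE cell -/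

section TreeExamples

/-- the (1,11) cell of Parts I/II (`exB`, `exRho`) as a tree cell `b : ℕ → ℤ`. -/
def exCell : ℕ → ℤ := fun i => [28, 10, 9, 9, 8, 7, 7, 7].getD i 0

/-- its ρ at `(m,p) = (1,11)` is Part I's `exRho` read through `lowerB`, and `R₀ = 17`. -/
example : rhob 11 1 (exCell 0) (lowerB exCell) = ![8, 10, 10, 12, 14, 14, 14] ∧ R0b 11 1 (exCell 0) = 17 := by
  refine ⟨?_, by decide⟩; funext j; fin_cases j <;> decide

/-- class `u = 1` ↔ residue `x = 8` (`t(0,1) = 9`, `t(1,1) = 20`: positions 8, 19); class `u = 11 = p` (self-mirror;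
`b₀ = 28` even, `m = 1` odd: `d(1,11) = 0`, the merged even centre at position 14 = b₀/2) ↔ residue `x = 3`
(`t(ℓ,11) = 4 + 11ℓ`: positions 3, 14, 25). -/
example : uOf 11 1 28 8 = 1 ∧ uOf 11 1 28 3 = 11 ∧ tOf 11 1 28 0 1 = 9 ∧ tOf 11 1 28 1 1 = 20 ∧
    tOf 11 1 28 0 11 = 4 ∧ tOf 11 1 28 1 11 = 15 ∧ tOf 11 1 28 2 11 = 26 := by decide

/-- the tree's `netExp` along the class of `x = 8` (positions 8, 19): pole orders 3 and 5 (Part II's kernel example: class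
`u = 1` lies in `4 = 7 − L` blocks at level 0, in 6 at level 1); along `x = 3` (positions 3, 14, 25 = levels 0, 1, 2 of
the class `u = 11`): `+1, −6+1, +1` — two uncancelled numerator ZEROS (`ord = −1`: the pole-frame level 0 carries excess
`6 − (−1) = 7 = L(11)`, the level `2 = 3m−1` is the `n₊` zero) and all seven blocks plus the merged even centre at 14. -/
example : netExp exCell 8 = -3 ∧ netExp exCell 19 = -5 ∧ netExp exCell 3 = 1 ∧ netExp exCell 14 = -5 ∧
    netExp exCell 25 = 1 := by decide

/-- **`E_x` by the tree's definition vs the formula**: `classExp exCell 11 8 = −8 = scoreA(1) − 12` (`δ_A(1) = 4`, no centre)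
and `classExp exCell 11 3 = −3 = scoreA(11) − 12` (`δ_A(11) = L + n₊ = 7 + 1 = 8`, centre unit 1). -/
example : classExp exCell 11 8 = -8 ∧ scoreA 11 17 ![8, 10, 10, 12, 14, 14, 14] 1 = 4 ∧
    classExp exCell 11 3 = -3 ∧ scoreA 11 17 ![8, 10, 10, 12, 14, 14, 14] 11 = 9 := by decide

end TreeExamples

end TreeBridge

end Summit.KontsevichZagierPeriods.Zeta5Search.DenomLaw.ThresholdModel.Rho
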